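import Mathlib
import Summits.ResolutionOfSingularities.ResolutionOfSingularities.Theorems.WeightedInvariantLocalWeightedDropMonomialCloudStep
import Summits.ResolutionOfSingularities.ResolutionOfSingularities.Theorems.WeightedInvariantLocalWeightedDropMonomialPhaseChart
import Summits.ResolutionOfSingularities.ResolutionOfSingularities.Theorems.WeightedInvariantLocalWeightedDropTupleDropAssembly

/-!
# `WeightedInvariant.LocalWeightedDrop`, line `tame-four-tuple-drop`: THE MONOMIAL PHASE OF THE TUPLE GAME IN ANY NUMBER OF VARIABLES
# (stub (B3) `stub_spaceMonomialPhase`, three variables, VERBATIM; and the assembly (B3)+(G3) in every dimension)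

Crux item stmt-ResolutionOfSingularities-8899 `LocalWeightedDrop` (route `ResolutionOfSingularities/WeightedInvariant`); strategist
res-L1-w43-strat-1's line `tame-four-tuple-drop` (`L/res-L1-w43-strat-1/tame_four_tuple_drop_v1.lean`, sha16 9c94f6e133b67480) for the
N = 4 TAME residual `stub_tameWideApexFourStartsWon`.  [OURS · L1 W4.3, chain w43, unit res-L1-w43-stub-8 (seat res-D-pv-006); the mathematics
is the marked form of Hironaka's polyhedra game — the pair step of arXiv:1907.02094 Prop. 2.2 (Spivakovsky 1983) made positional
(`…MonomialCloudPairs`, `…MonomialCloudStep`) — transported to the coefficient-tuple game by the unit-monomial chart algebra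
(`…MonomialPhaseChart`); NOT a statement of any manuscript.]

* `TupleMonomialPhase.mu a` — THE RANK: the least cloud potential `MonomialCloud.mu` of the normalised exponent cloud
  `(v_{j,i} · L/m_j)` (`L = (e + 2)!`, `m_j` the marking) of a presentation of `a` (a legal `Φ` with `a_j∘Φ = u_j · ∏ xᵢ^{v_{j,i}}` for
  every non-zero entry); `0` if there is none; `mu a < ω³`.
* `TupleMonomialPhase.stepDrop` — THE STEP: from a non-zero bad tuple whose support product has normal-crossing support, the move read off a
  minimising presentation — the centre `{xᵢ = 0 : i ∈ J}` of `MonomialCloud.exists_move` in the presentation's coordinates — keeps the support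
  product a normal crossing and lowers `mu` at EVERY successor (the successor's identity presentation has the cloud
  `(MonomialCloud.succ J l Z (L·W) v̂_j) ∘ (Fin.cases l l.succAbove)`).
* `germMonomialPhase` — the monomial phase in `n + 1` variables = hypothesis `hmono` of `tupleDrop_of_count_of_monomialPhase n GermIsNC` (p501911);
  `tupleDrop_of_germNonNCCountRad` — hence the tuple game `TupleGame.Drop k (n + 1) e` is won, for every `e`, from a radical non-normal-crossing
  count with free smooth centres ALONE (strat-1's (A3)-shape hypothesis `GermNonNCCountRad k n`), in every dimension.
* `TameFourTupleDrop.SpaceMonomialPhase` (the line file's (B3) notion, VERBATIM) and **`stub_spaceMonomialPhase : ∀ k, SpaceMonomialPhase k`**.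
-/

set_option linter.dupNamespace false -- mandated namespace of this single-conjunct summit

namespace Summit.ResolutionOfSingularities.ResolutionOfSingularities.Theorems

open Literature.AlgebraicGeometry.Resolution

namespace TupleMonomialPhase

open MvPowerSeries

variable {k : Type} [Field k] {n e : ℕ}

/-! ### The normalised cloud of a presentation and the rank -/

open scoped Classical in
/-- THE NORMALISED EXPONENT CLOUD of exponents `v` on the support of `a`: `(v_{j,i} · L/m_j)` for `a_j ≠ 0`. -/
noncomputable def cloud (a : Fin (e + 1) → MvPowerSeries (Fin (n + 1)) k) (v : Fin (e + 1) → Fin (n + 1) → ℕ) :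
    {j : Fin (e + 1) // a j ≠ 0} → Fin (n + 1) → ℕ :=
  fun j i => v j.1 i * ((e + 2).factorial / TupleGame.marking e j.1)

open scoped Classical in
/-- THE RANK `mu a`: the least cloud potential of a presentation of `a`; `0` if there is none. -/
noncomputable def mu (a : Fin (e + 1) → MvPowerSeries (Fin (n + 1)) k) : Ordinal.{0} :=
  sInf {o | ∃ (Φ : Fin (n + 1) → MvPowerSeries (Fin (n + 1)) k) (v : Fin (e + 1) → Fin (n + 1) → ℕ),
    (∀ i, constantCoeff (Φ i) = 0) ∧
    IsUnit (Matrix.det (Matrix.of fun i j => coeff (Finsupp.single j 1) (Φ i))) ∧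
    (∀ j, a j ≠ 0 → ∃ u : MvPowerSeries (Fin (n + 1)) k, constantCoeff u ≠ 0 ∧ subst Φ (a j) = u * ∏ i, X i ^ v j i) ∧
    o = MonomialCloud.mu (cloud a v)}

open scoped Classical in
/-- `mu a` is at most the potential of any presentation. -/
theorem mu_le {a : Fin (e + 1) → MvPowerSeries (Fin (n + 1)) k} {Φ : Fin (n + 1) → MvPowerSeries (Fin (n + 1)) k}
    {v : Fin (e + 1) → Fin (n + 1) → ℕ} (hΦ0 : ∀ i, constantCoeff (Φ i) = 0)
    (hdet : IsUnit (Matrix.det (Matrix.of fun i j => coeff (Finsupp.single j 1) (Φ i))))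
    (hpres : ∀ j, a j ≠ 0 → ∃ u : MvPowerSeries (Fin (n + 1)) k, constantCoeff u ≠ 0 ∧ subst Φ (a j) = u * ∏ i, X i ^ v j i) :
    mu a ≤ MonomialCloud.mu (cloud a v) :=
  csInf_le' ⟨Φ, v, hΦ0, hdet, hpres, rfl⟩

open scoped Classical in
/-- If `a` has a presentation then `mu a` is attained by one. -/
theorem mu_mem {a : Fin (e + 1) → MvPowerSeries (Fin (n + 1)) k}
    (h : ∃ (Φ : Fin (n + 1) → MvPowerSeries (Fin (n + 1)) k) (v : Fin (e + 1) → Fin (n + 1) → ℕ),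
      (∀ i, constantCoeff (Φ i) = 0) ∧
      IsUnit (Matrix.det (Matrix.of fun i j => coeff (Finsupp.single j 1) (Φ i))) ∧
      (∀ j, a j ≠ 0 → ∃ u : MvPowerSeries (Fin (n + 1)) k, constantCoeff u ≠ 0 ∧ subst Φ (a j) = u * ∏ i, X i ^ v j i)) :
    ∃ (Φ : Fin (n + 1) → MvPowerSeries (Fin (n + 1)) k) (v : Fin (e + 1) → Fin (n + 1) → ℕ),
      (∀ i, constantCoeff (Φ i) = 0) ∧
      IsUnit (Matrix.det (Matrix.of fun i j => coeff (Finsupp.single j 1) (Φ i))) ∧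
      (∀ j, a j ≠ 0 → ∃ u : MvPowerSeries (Fin (n + 1)) k, constantCoeff u ≠ 0 ∧ subst Φ (a j) = u * ∏ i, X i ^ v j i) ∧
      MonomialCloud.mu (cloud a v) = mu a := by
  obtain ⟨Φ, v, h1, h2, h3⟩ := h
  set T : Set Ordinal.{0} := {o | ∃ (Φ : Fin (n + 1) → MvPowerSeries (Fin (n + 1)) k) (v : Fin (e + 1) → Fin (n + 1) → ℕ),
    (∀ i, constantCoeff (Φ i) = 0) ∧
    IsUnit (Matrix.det (Matrix.of fun i j => coeff (Finsupp.single j 1) (Φ i))) ∧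
    (∀ j, a j ≠ 0 → ∃ u : MvPowerSeries (Fin (n + 1)) k, constantCoeff u ≠ 0 ∧ subst Φ (a j) = u * ∏ i, X i ^ v j i) ∧
    o = MonomialCloud.mu (cloud a v)} with hT
  have hmem : sInf T ∈ T := csInf_mem ⟨_, Φ, v, h1, h2, h3, rfl⟩
  obtain ⟨Φ', v', h1', h2', h3', ho⟩ := hmem
  exact ⟨Φ', v', h1', h2', h3', ho.symm⟩

open scoped Classical in
/-- `mu a < ω³`. -/
theorem mu_lt (a : Fin (e + 1) → MvPowerSeries (Fin (n + 1)) k) : mu a < Ordinal.omega0 ^ 3 := by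
  by_cases h : ∃ (Φ : Fin (n + 1) → MvPowerSeries (Fin (n + 1)) k) (v : Fin (e + 1) → Fin (n + 1) → ℕ),
      (∀ i, constantCoeff (Φ i) = 0) ∧
      IsUnit (Matrix.det (Matrix.of fun i j => coeff (Finsupp.single j 1) (Φ i))) ∧
      (∀ j, a j ≠ 0 → ∃ u : MvPowerSeries (Fin (n + 1)) k, constantCoeff u ≠ 0 ∧ subst Φ (a j) = u * ∏ i, X i ^ v j i)
  · obtain ⟨Φ, v, h1, h2, h3⟩ := h
    exact (mu_le h1 h2 h3).trans_lt (MonomialCloud.mu_lt _)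
  · have h0 : mu a = 0 := by
      unfold mu
      convert Ordinal.sInf_empty
      ext o
      simp only [Set.mem_setOf_eq, Set.mem_empty_iff_false, iff_false]
      rintro ⟨Φ, v, h1, h2, h3, -⟩
      exact h ⟨Φ, v, h1, h2, h3⟩
    rw [h0]
    exact pow_pos Ordinal.omega0_pos 3

/-! ### Arithmetic of the normalisation -/

/-- A bad tuple has a bad normalised cloud: `L ≤ |v̂_j|`. -/
theorem factorial_le_total {a : Fin (e + 1) → MvPowerSeries (Fin (n + 1)) k} (hbad : TupleGame.Bad a)
    {Φ : Fin (n + 1) → MvPowerSeries (Fin (n + 1)) k} (hΦ0 : ∀ i, constantCoeff (Φ i) = 0) {v : Fin (e + 1) → Fin (n + 1) → ℕ}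
    (hpres : ∀ j, a j ≠ 0 → ∃ u : MvPowerSeries (Fin (n + 1)) k, constantCoeff u ≠ 0 ∧ subst Φ (a j) = u * ∏ i, X i ^ v j i)
    (j : {j : Fin (e + 1) // a j ≠ 0}) : (e + 2).factorial ≤ MonomialCloud.total (cloud a v j) := by
  obtain ⟨u, hu, h⟩ := hpres j.1 j.2
  have hm := marking_le_total hbad hΦ0 j.2 hu h
  unfold MonomialCloud.total cloud
  rw [← Finset.sum_mul]
  calc (e + 2).factorial = TupleGame.marking e j.1 * ((e + 2).factorial / TupleGame.marking e j.1) :=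
        (PlaneMonomialPhase.marking_mul_scale e j.1).symm
    _ ≤ (∑ i, v j.1 i) * ((e + 2).factorial / TupleGame.marking e j.1) := Nat.mul_le_mul_right _ hm

/-- The sum of the normalised exponents over `J` is the normalised sum. -/
theorem sum_cloud {a : Fin (e + 1) → MvPowerSeries (Fin (n + 1)) k} (v : Fin (e + 1) → Fin (n + 1) → ℕ)
    (J : Finset (Fin (n + 1))) (j : {j : Fin (e + 1) // a j ≠ 0}) :
    ∑ i ∈ J, cloud a v j i = (∑ i ∈ J, v j.1 i) * ((e + 2).factorial / TupleGame.marking e j.1) := by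
  unfold cloud
  rw [Finset.sum_mul]

/-! ### The re-indexing of the coordinates after a slice -/

/-- The map `0 ↦ l`, `q.succ ↦ l.succAbove q` is a bijection of `Fin (n + 1)`. -/
theorem bijective_cases_succAbove (l : Fin (n + 1)) :
    Function.Bijective (fun i' : Fin (n + 1) => (Fin.cases (motive := fun _ => Fin (n + 1)) l (fun q => l.succAbove q) i')) := by
  rw [Fintype.bijective_iff_injective_and_card]
  refine ⟨?_, rfl⟩
  intro i₁ i₂ h
  induction i₁ using Fin.cases with
  | zero =>
    induction i₂ using Fin.cases with
    | zero => rfl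
    | succ q₂ => simp only [Fin.cases_zero, Fin.cases_succ] at h; exact absurd h.symm (Fin.succAbove_ne l q₂)
  | succ q₁ =>
    induction i₂ using Fin.cases with
    | zero => simp only [Fin.cases_zero, Fin.cases_succ] at h; exact absurd h (Fin.succAbove_ne l q₁)
    | succ q₂ => simp only [Fin.cases_succ] at h; rw [Fin.succAbove_right_inj.mp h]

/-- The re-indexing as an equivalence. -/
noncomputable def sigma (l : Fin (n + 1)) : Fin (n + 1) ≃ Fin (n + 1) :=
  Equiv.ofBijective _ (bijective_cases_succAbove l)

/-- Values of the re-indexing. -/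
theorem sigma_zero (l : Fin (n + 1)) : sigma l 0 = l := by
  simp [sigma]

/-- Values of the re-indexing. -/
theorem sigma_succ (l : Fin (n + 1)) (q : Fin n) : sigma l q.succ = l.succAbove q := by
  simp [sigma]

/-! ### The step -/

open scoped Classical in
/-- THE STEP OF THE MONOMIAL PHASE (any number `n + 1` of variables, any field): from a non-zero bad tuple with normal-crossing support
product, the move read off a minimising presentation keeps the support product a normal crossing and lowers `mu` at every non-zero bad
successor. -/
theorem stepDrop (a : Fin (e + 1) → MvPowerSeries (Fin (n + 1)) k) (ha : a ≠ 0) (hbad : TupleGame.Bad a)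
    (hnc : TameFourTupleDrop.GermIsNC (TupleGame.prodSupport a)) :
    TupleGame.StepDrop mu (fun b => TameFourTupleDrop.GermIsNC (TupleGame.prodSupport b)) a := by
  -- a presentation realising `mu a`
  obtain ⟨Φ₁, hΦ₁0, hΦ₁det, hex⟩ := exists_presentation a hnc
  choose v₁ hv₁ using hex
  obtain ⟨Φ, v, hΦ0, hdet, hpres, hmin⟩ := mu_mem (a := a) ⟨Φ₁, v₁, hΦ₁0, hΦ₁det, hv₁⟩
  -- the cloud and its move
  obtain ⟨j₁, hj₁⟩ : ∃ j, a j ≠ 0 := by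
    by_contra h
    push Not at h
    exact ha (funext h)
  set S := {j : Fin (e + 1) // a j ≠ 0} with hS
  set V : S → Fin (n + 1) → ℕ := cloud a v with hV
  set L : ℕ := (e + 2).factorial with hL
  have hL1 : 1 ≤ L := Nat.factorial_pos _
  have hbadV : ∀ j : S, L ≤ MonomialCloud.total (V j) := fun j => factorial_le_total hbad hΦ0 hpres j
  obtain ⟨J, hJ, hmove⟩ := MonomialCloud.exists_move V ⟨j₁, hj₁⟩ hL1 hbadV
  -- THE MOVE `(Φ, 𝟙_J)`
  refine ⟨Φ, fun i => if i ∈ J then 1 else 0, hΦ0, hdet, fun i => ?_, ?_, ?_⟩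
  · dsimp only
    split_ifs <;> omega
  · obtain ⟨i, hi⟩ := hJ
    exact ⟨i, by simp [hi]⟩
  intro c hconv hc D G hfac
  -- a live slot
  obtain ⟨l, hcl⟩ : ∃ l, c l ≠ 0 := by
    by_contra h
    push Not at h
    exact hc (funext h)
  have hJc : ∀ i, c i ≠ 0 → i ∈ J := by
    intro i hi
    by_contra h
    exact hi (hconv i (by simp [h]))
  have hlJ : l ∈ J := hJc l hcl
  refine ⟨l, hcl, fun _ _ => ?_⟩
  -- the successor entries
  have hnew := newTuple_slot hpres J c hconv hcl D G hfac
  set b := TupleGame.newTuple a D G l with hb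
  have hb0 : ∀ j, a j = 0 → b j = 0 := fun j hj => PlaneMonomialPhase.newTuple_of_eq_zero D G l hj
  set v' : Fin (e + 1) → Fin (n + 1) → ℕ := fun j i' => Fin.cases (motive := fun _ => ℕ)
    (D j - TupleGame.marking e j * TupleGame.floorWeight a D) (fun q => if c (l.succAbove q) = 0 then v j (l.succAbove q) else 0) i'
    with hv'
  have hbpres : ∀ j, a j ≠ 0 → ∃ u : MvPowerSeries (Fin (n + 1)) k, constantCoeff u ≠ 0 ∧ b j = u * ∏ i, X i ^ v' j i := by
    intro j hj
    obtain ⟨-, u', hu', h⟩ := hnew j hj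
    exact ⟨u', hu', h⟩
  have hsupp : ∀ j, b j ≠ 0 ↔ a j ≠ 0 := by
    intro j
    refine ⟨fun h h0 => h (hb0 j h0), fun h h0 => ?_⟩
    obtain ⟨u, hu, hj⟩ := hbpres j h
    exact unitMonomial_ne_zero hu _ (hj ▸ h0)
  have hbpres' : ∀ j, b j ≠ 0 → ∃ u : MvPowerSeries (Fin (n + 1)) k, constantCoeff u ≠ 0 ∧
      subst X (b j) = u * ∏ i, X i ^ v' j i := by
    intro j hj
    rw [subst_self]
    exact hbpres j ((hsupp j).mp hj)
  constructor
  · -- the support product stays a normal crossing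
    exact germIsNC_prodSupport b fun j hj => by
      obtain ⟨u, hu, h⟩ := hbpres j ((hsupp j).mp hj)
      exact ⟨u, v' j, hu, h⟩
  · -- the rank drops
    set W := TupleGame.floorWeight a D with hW
    set Z : Finset (Fin (n + 1)) := (J.erase l).filter (fun i => c i ≠ 0) with hZ
    have hZsub : Z ⊆ J.erase l := Finset.filter_subset _ _
    have hD : ∀ j : S, D j.1 = ∑ i ∈ J, v j.1 i := fun j => (hnew j.1 j.2).1
    -- the floor-weight conditions in normalised units
    have hsumV : ∀ j : S, ∑ i ∈ J, V j i = D j.1 * ((e + 2).factorial / TupleGame.marking e j.1) := fun j => by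
      rw [hV, sum_cloud, hD j]
    have hW1 : ∀ j : S, L * W ≤ ∑ i ∈ J, V j i := by
      intro j
      rw [hsumV j, hL]
      calc (e + 2).factorial * W = TupleGame.marking e j.1 * ((e + 2).factorial / TupleGame.marking e j.1) * W := by
            rw [PlaneMonomialPhase.marking_mul_scale]
        _ = TupleGame.marking e j.1 * W * ((e + 2).factorial / TupleGame.marking e j.1) := Nat.mul_right_comm _ _ _
        _ ≤ D j.1 * ((e + 2).factorial / TupleGame.marking e j.1) :=
            Nat.mul_le_mul_right _ (TupleGame.marking_mul_floorWeight_le D j.2)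
    have hW2 : (∀ j : S, L ≤ ∑ i ∈ J, V j i) → 1 ≤ W := by
      intro h
      refine PlaneMonomialPhase.one_le_floorWeight ha D fun j hj => ?_
      have h1 := h ⟨j, hj⟩
      rw [hsumV ⟨j, hj⟩, hL] at h1
      have h2 : TupleGame.marking e j * ((e + 2).factorial / TupleGame.marking e j) ≤
          D j * ((e + 2).factorial / TupleGame.marking e j) := by
        rw [PlaneMonomialPhase.marking_mul_scale]; exact h1
      exact Nat.le_of_mul_le_mul_right h2 (PlaneMonomialPhase.scale_pos e j)
    have hdrop := hmove W hW1 hW2 l hlJ Z hZsub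
    -- the successor's cloud in the identity presentation
    have hcloud : cloud b v' ∘ (Equiv.subtypeEquivRight hsupp).symm =
        fun j : S => MonomialCloud.succ J l Z (L * W) (V j) ∘ sigma l := by
      funext j
      funext i'
      simp only [Function.comp_apply]
      have hj : (((Equiv.subtypeEquivRight hsupp).symm j) : Fin (e + 1)) = j.1 := rfl
      unfold cloud MonomialCloud.succ
      rw [hj]
      induction i' using Fin.cases with
      | zero =>
        rw [sigma_zero, if_pos rfl, hv']
        simp only [Fin.cases_zero]
        rw [hsumV j, hL, Nat.sub_mul, Nat.mul_right_comm, PlaneMonomialPhase.marking_mul_scale]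
      | succ q =>
        rw [sigma_succ, if_neg (Fin.succAbove_ne l q), hv']
        simp only [Fin.cases_succ]
        have hmemZ : l.succAbove q ∈ Z ↔ c (l.succAbove q) ≠ 0 := by
          rw [hZ, Finset.mem_filter, Finset.mem_erase]
          constructor
          · exact fun h => h.2
          · intro h
            exact ⟨⟨Fin.succAbove_ne l q, hJc _ h⟩, h⟩
        by_cases h0 : c (l.succAbove q) = 0
        · rw [if_pos h0, if_neg (fun h => (hmemZ.mp h) h0)]
          rfl
        · rw [if_neg h0, if_pos (hmemZ.mpr h0), zero_mul]
    calc mu b ≤ MonomialCloud.mu (cloud b v') := mu_le (fun i => constantCoeff_X i) isUnit_det_X hbpres'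
      _ = MonomialCloud.mu (cloud b v' ∘ (Equiv.subtypeEquivRight hsupp).symm) :=
          (MonomialCloud.mu_comp_index_equiv (Equiv.subtypeEquivRight hsupp).symm (cloud b v')).symm
      _ = MonomialCloud.mu (fun j : S => MonomialCloud.succ J l Z (L * W) (V j) ∘ sigma l) := by rw [hcloud]
      _ = MonomialCloud.mu (fun j : S => MonomialCloud.succ J l Z (L * W) (V j)) := MonomialCloud.mu_comp_equiv _ _
      _ < MonomialCloud.mu V := hdrop
      _ = mu a := hmin

end TupleMonomialPhase

/-! ### The monomial phase in every dimension, and the line's (B3) -/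

/-- **THE MONOMIAL PHASE OF THE TUPLE GAME IN `n + 1` VARIABLES** (every field, every `e`): a rank `μ < ω³` on coefficient tuples which,
from a non-zero bad tuple whose support product has normal-crossing support, drops after some move at every non-zero bad successor while
keeping that property — the hypothesis `hmono` of `tupleDrop_of_count_of_monomialPhase n TameFourTupleDrop.GermIsNC` (p501911). [OURS · L1 W4.3] -/
theorem germMonomialPhase (k : Type) [Field k] (n e : ℕ) :
    ∃ (β : Ordinal.{0}) (μ : (Fin (e + 1) → MvPowerSeries (Fin (n + 1)) k) → Ordinal.{0}),
      (∀ a, μ a < β) ∧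
      ∀ a : Fin (e + 1) → MvPowerSeries (Fin (n + 1)) k, a ≠ 0 → TupleGame.Bad a →
        TameFourTupleDrop.GermIsNC (TupleGame.prodSupport a) →
        TupleGame.StepDrop μ (fun b => TameFourTupleDrop.GermIsNC (TupleGame.prodSupport b)) a :=
  ⟨Ordinal.omega0 ^ 3, TupleMonomialPhase.mu, TupleMonomialPhase.mu_lt, TupleMonomialPhase.stepDrop⟩

/-- **THE TUPLE GAME IN `n + 1` VARIABLES IS WON FROM A RADICAL NON-NORMAL-CROSSING COUNT ALONE** (every dimension, every field, every `e`):
strategist res-L1-w43-strat-1's (A3)-shape count `GermNonNCCountRad k n` gives `TupleGame.Drop k (n + 1) e` — res-type-088's assembly (p501911)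
fed with `germMonomialPhase`. [OURS · L1 W4.3] -/
theorem tupleDrop_of_germNonNCCountRad (k : Type) [Field k] (n : ℕ) (hrad : TameFourTupleDrop.GermNonNCCountRad k n) :
    ∀ e : ℕ, TupleGame.Drop k (n + 1) e := by
  obtain ⟨ν, h₁, h₂, h₃⟩ := hrad
  exact tupleDrop_of_count_of_monomialPhase n TameFourTupleDrop.GermIsNC ν h₁ h₂ h₃ (germMonomialPhase k n)

namespace TameFourTupleDrop

variable (k : Type) [Field k] in
/-- THE MONOMIAL PHASE OF THE TUPLE GAME IN THREE VARIABLES (the hypothesis (S3b) of `stub_tupleDropPlane` one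
dimension up, with an arbitrary uniform ordinal bound `β` in place of `ω²`): for every `e`, a rank `μ < β` on coefficient
tuples which, from a non-zero bad tuple whose support product is a normal crossing, drops after some move at every
non-zero bad successor while keeping the support product a normal crossing.  [VERBATIM from strategist res-L1-w43-strat-1's line file
`tame_four_tuple_drop_v1.lean`.] -/
def SpaceMonomialPhase : Prop :=
  ∀ e : ℕ, ∃ (β : Ordinal.{0}) (μ : (Fin (e + 1) → MvPowerSeries (Fin 3) k) → Ordinal.{0}),
    (∀ a, μ a < β) ∧
    ∀ a : Fin (e + 1) → MvPowerSeries (Fin 3) k, a ≠ 0 → TupleGame.Bad a →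
      SpaceIsNC (TupleGame.prodSupport a) →
      TupleGame.StepDrop μ (fun b => SpaceIsNC (TupleGame.prodSupport b)) a

/-- **(B3) THE MONOMIAL PHASE IN THREE VARIABLES** — stub `stub_spaceMonomialPhase` of the line `tame-four-tuple-drop`, VERBATIM: every field.
(`SpaceIsNC = GermIsNC` at `Fin 3`, `spaceIsNC_iff`; instance `n + 1 = 3` of `germMonomialPhase`.) [OURS · L1 W4.3] -/
theorem stub_spaceMonomialPhase : ∀ (k : Type) [Field k], SpaceMonomialPhase k := by
  intro k _ e
  exact germMonomialPhase k 2 e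

/-- (B3)+(G3) at the literal `Fin 3`: the three-variable tuple game is won from the line's count (A3)-shape hypothesis `SpaceGermNonNCCountRad k`. -/
theorem tupleDropThree_of_spaceGermNonNCCountRad (k : Type) [Field k] (hrad : SpaceGermNonNCCountRad k) :
    ∀ e : ℕ, TupleGame.Drop k 3 e :=
  tupleDrop_of_germNonNCCountRad k 2 (spaceGermNonNCCountRad_iff.mp hrad)

end TameFourTupleDrop

end Summit.ResolutionOfSingularities.ResolutionOfSingularities.Theorems
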